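/-
Copyright (c) 2026 the pub-hodgecm-mathlib formalisation cell (harness21).  Prover seat hodgecm-mathlib-F0P3a-p03 (g18): road «S3-ram» (LEAD F0P3a-plan (g13)), the
type-(2) G-side (Cnt2′) assembly (chair F0P3a-p07 (g14) chain «… ⟸ block law (… + p03 arithmetic)»; (α) keeper A-p19 (g28) `stub_arith`); 2026-09-02.
-/
import Literature.NumberTheory.Rogawski1990.DepthZeroKappaTransferTypeOneRamifiedShellSums   -- ★ p847094 (F0P3a-p01 (g16)): the ShellSums closed forms `S(E_m)`, `S(O_m)`, `S(P±_m)` whose spellings are used below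
import HarnessLib

/-!
# The ARITHMETIC of the (Cnt2′) block law: closed totals of the two literals differ by `±q^m·X̃_j(n)` — regimes «`d_u > N` even» and «`d_u < N`» (field identities)

Topic `NumberTheory/Rogawski1990`; namespace `Literature.NumberTheory.Rogawski1990.BlockLawArith`.  THEOREMS ONLY (no definition, no instance, no notation, no named fact,
no `sorry`); kernel lane `--supports stmt-HodgeConjecture-24833`; PURE ALGEBRA over a field `K` of characteristic `0` (consumed at `K = ℂ`, `q = N𝔭_v`).  Cell
`pub/hodgecm-mathlib` (D-0151), crux H413; road «S3-ram» (Literature seeding, count-neutral).  The block-law sockets of the (Cnt2′) skeleton v4.3 (`hBlockLaw` of ★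
p848712∕p848727) ask, per row `j` and parity, `Z_j(hyperbolic literal) − Z_j(anisotropic literal) = (β,θ)_v·q^m·X̃_j(n)`; route B (★ p848758∕p848814 `strataCount_J₀_block_raw`)
delivers each `Z_j` as `#R·e₀ + NE·S(E_{mA+1}) + NP·S(P⁺_{mA}) + NM·S(P⁻_{mA})` (odd top depth) ∕ `#R·e₀ + NO·S(O_{mA}) + …` (even top depth) in the ★ ShellSums closed forms,
and the census supplies `(#R, NE∣NO, NP, NM)` per literal and regime (my REGIME TABLE `F0/P3a/F0P3a-p03/g18/arith/REGIME-TABLE-censusClosedForms.v1.F0P3ap03g18.md`,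
certified on B-p14 (g40)'s 164 literal-rows).  THIS FILE proves the resulting FIELD IDENTITIES for the two regimes where the sign is forced:
* §1 helpers (shifted and even-step geometric sums in closed form);
* §2 regime «A-even» `d_u > N = 2(m+1)` (τ = −1; favourable = anisotropic: `Z(t₁) = e₀ + (q+1)q·S(O_m)`; unfavourable hyperbolic total `(0,0,(q+1)∕2·q^{2m}, same,
  (q+1)Σ_{i<m} q^{2i})`): rows `0` and `1±` — `Z_j(t₀) − Z_j(t₁) = −q^{N}·X̃_j(m+1)`;
* §3 regime «B» `d_u = 2k+3 < N` (τ = +1; favourable = hyperbolic with the REGIME-TABLE census `#R = m0(N−2k−2)`, `NE = m0(N−2k) − m0(N−2k−2)`,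
  `NP + NM = (q−1)q·#R`, `|NP − NM| = (q+1)q`; unfavourable anisotropic `Z(t₁) = e₀ + (q+1)q·S(P_k)`): rows `0` and `1±`, both parities of `N` —
  `Z_j(t₀) − Z_j(t₁) = +q^{2k+3}·X̃_j(n)` (`Nat.cast_choose_two` reads the ShellSums `C(q,2)` as `q(q−1)∕2`).
* §7 (ED. 5) rows `1±` of regime B without division: `pm_B_{even,odd}_census_{major,minor}` (orientation as two cases, `ℕ`-friendly census atoms).
* §6 (ED. 4) CENSUS ADAPTERS `…_census`: the same identities on ABSTRACT census atoms (`R NE NP NM Na`, `Nh Nan`, `NO`, `F U`…) + census equalities, closed by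
  `linear_combination` — the (α) keeper's v1 `J0diff` branch shape (RULING (13) (1)).
* §5 (ED. 3) the eight identities at `K = ℂ`, `q = (Ideal.absNorm v.asIdeal : ℂ)` with the side conditions discharged (`…_absNorm`).
* §4 (ED. 2) regime «A-odd» `d_u > N = 2m+3` (either sign; B-p14 (g40) MEMO v2 law (L1)): rows `0` and `1±` — `Z_j(fav) − Z_j(unf) = q^N·X̃_j(m+1)`.
Each identity is stated with the sums in the ★ ShellSums spelling (`∑ i ∈ Finset.range m, q ^ (2 * i)`, `∑ i ∈ Finset.range m, q ^ (2 * m - 1 + i)`, …) over `q : K` with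
`q ≠ 0, q ≠ ±1`, and the socket's `X̃_j` spelling on the right; the proofs rewrite every sum in closed form (`geom_sum_eq`) and finish by `field_simp` + `ring`.
HONEST LABEL: HC_CM is proved only modulo the 2 remaining named inputs (hLiu418 24832, h413 24833) until rung 0 closes; elementary algebra, asserts nothing printed.

## References
* [Rogawski1990] J. D. Rogawski, *Automorphic Representations of Unitary Groups in Three Variables*, Ann. of Math. Stud. 123 (1990), §4.9 Prop. 4.9.1 (a)(b) p. 55, Lemma 4.9.3
  p. 56 (the signed fixed-lattice count these identities assemble).
* [Kottwitz1986] R. E. Kottwitz, *Base change for unit elements of Hecke algebras*, Compositio Math. 60 (1986), §3 (counting by shells).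
* [Serre1980Trees] J.-P. Serre, *Trees* (1980), Ch. II §1.1 (balls and spheres in a regular tree: geometric sums).
-/

set_option autoImplicit false

namespace Literature.NumberTheory.Rogawski1990.BlockLawArith

open Finset

variable {K : Type*} [Field K]

/-! ## §1 Geometric sums in closed form (the shapes met in ★ ShellSums) -/

/-- `∑_{i<m} q^{c+i} = q^c · ∑_{i<m} q^i`. [cite: Serre1980Trees, II.1.1] -/
theorem sum_range_pow_add (q : K) (c m : ℕ) : ∑ i ∈ range m, q ^ (c + i) = q ^ c * ∑ i ∈ range m, q ^ i := by
  rw [mul_sum]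
  exact sum_congr rfl fun i _ => pow_add q c i

/-- `∑_{i<m} q^i = (q^m − 1)∕(q − 1)` (`q ≠ 1`). [cite: Serre1980Trees, II.1.1] -/
theorem sum_range_pow_eq_div (q : K) (hq1 : q ≠ 1) (m : ℕ) : ∑ i ∈ range m, q ^ i = (q ^ m - 1) / (q - 1) :=
  geom_sum_eq hq1 m

/-- `∑_{i<m} q^{2i} = (q^{2m} − 1)∕(q² − 1)` (`q² ≠ 1`). [cite: Serre1980Trees, II.1.1] -/
theorem sum_range_pow_two_mul_eq_div (q : K) (hq2 : q ^ 2 ≠ 1) (m : ℕ) : ∑ i ∈ range m, q ^ (2 * i) = (q ^ (2 * m) - 1) / (q ^ 2 - 1) := by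
  have h : ∑ i ∈ range m, q ^ (2 * i) = ∑ i ∈ range m, (q ^ 2) ^ i := sum_congr rfl fun i _ => pow_mul q 2 i
  rw [h, geom_sum_eq hq2 m, ← pow_mul]

/-- `∑_{i<m} q^{c+i} = q^c (q^m − 1)∕(q − 1)` (`q ≠ 1`). [cite: Serre1980Trees, II.1.1] -/
theorem sum_range_pow_add_eq_div (q : K) (hq1 : q ≠ 1) (c m : ℕ) : ∑ i ∈ range m, q ^ (c + i) = q ^ c * ((q ^ m - 1) / (q - 1)) := by
  rw [sum_range_pow_add, geom_sum_eq hq1 m]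

/-- The ★ ShellSums shifted sum `∑_{i<m} q^{2m−1+i}` in closed form: `= q^{2m−1}(q^m − 1)∕(q − 1)`, the truncated exponent being harmless (at `m = 0` both sides vanish).
[cite: Serre1980Trees, II.1.1] -/
theorem sum_range_pow_two_mul_sub_one_add_eq (q : K) (hq1 : q ≠ 1) (m : ℕ) :
    ∑ i ∈ range m, q ^ (2 * m - 1 + i) = q ^ (2 * m - 1) * ((q ^ m - 1) / (q - 1)) :=
  sum_range_pow_add_eq_div q hq1 (2 * m - 1) m

/-! ## §2 Regime «A-even»: `d_u > N = 2(m+1)`, favourable = anisotropic literal -/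

/-- **ROW `0`, regime A-even** (`N = 2(m+1)`, `mA = m`): hyperbolic (unfavourable) total `(q+1)·Σ_{i<m} q^{2i}`, anisotropic (favourable) total `1 + (q+1)q·S(O_m)₀` with
`S(O_m)₀ = Σ_{i<m} q^{2i} + Σ_{i<m} q^{2m−1+i}` (★ ShellSums); their difference is `−q^N·X̃₀(m+1)`, `X̃₀(n) = ((q+1)Σ_{k<n} q^k − 1)∕q³` (the even-parity row-`0` socket form).
[cite: Rogawski1990, §4.9 Prop. 4.9.1 (a) p. 55] [cite: Kottwitz1986, §3] -/
theorem zero_Aeven (q : K) (hq0 : q ≠ 0) (hq1 : q ≠ 1) (hq1' : q + 1 ≠ 0) (m : ℕ) :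
    (q + 1) * ∑ i ∈ range m, q ^ (2 * i) - (1 + (q + 1) * q * (∑ i ∈ range m, q ^ (2 * i) + ∑ i ∈ range m, q ^ (2 * m - 1 + i))) =
      -(q ^ (2 * (m + 1)) * (((q + 1) * ∑ k ∈ range (m + 1), q ^ k - 1) / q ^ 3)) := by
  have hq2 : q ^ 2 ≠ 1 := fun h => by
    have h' : (q - 1) * (q + 1) = 0 := by linear_combination h
    rcases mul_eq_zero.1 h' with h1 | h1
    · exact hq1 (sub_eq_zero.1 h1)
    · exact hq1' h1
  have hqm1 : q - 1 ≠ 0 := sub_ne_zero.2 hq1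
  have hq21 : q ^ 2 - 1 ≠ 0 := sub_ne_zero.2 hq2
  rw [sum_range_pow_two_mul_eq_div q hq2, sum_range_pow_two_mul_sub_one_add_eq q hq1, sum_range_pow_eq_div q hq1]
  rcases m with _ | m
  · simp
    field_simp
    ring
  · rw [show 2 * (m + 1) - 1 = 2 * m + 1 by omega]
    field_simp
    ring

/-- **ROWS `1±`, regime A-even** (`N = 2(m+1)`): hyperbolic (unfavourable) total `(q+1)∕2·q^{2m}` in each class, anisotropic (favourable) total `(q+1)q·S(O_m)_{1±}` with
`S(O_m)_{1±} = C(q,2)·q^{2m−2}·Σ_{i<m} q^i`; difference `= −q^N·X̃_{1±}(m+1)`, `X̃_{1±}(n) = (q+1)(q^n − 2q)∕(2q³)` (even-parity `pm` socket form). `C(q,2)` enters as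
`q(q−1)∕2` (cast of `Nat.choose q 2`, see `pm_Aeven_natCast`). [cite: Rogawski1990, §4.9 Prop. 4.9.1 (a) p. 55] [cite: Kottwitz1986, §3] -/
theorem pm_Aeven (q : K) (hq0 : q ≠ 0) (hq1 : q ≠ 1) (h2 : (2 : K) ≠ 0) (m : ℕ) :
    (q + 1) / 2 * q ^ (2 * m) - (q + 1) * q * (q * (q - 1) / 2 * q ^ (2 * m - 2) * ∑ i ∈ range m, q ^ i) =
      -(q ^ (2 * (m + 1)) * ((q + 1) * (q ^ (m + 1) - 2 * q) / (2 * q ^ 3))) := by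
  have hqm1 : q - 1 ≠ 0 := sub_ne_zero.2 hq1
  rw [sum_range_pow_eq_div q hq1]
  rcases m with _ | m
  · simp
    field_simp
    ring
  · rw [show 2 * (m + 1) - 2 = 2 * m by omega]
    field_simp
    ring

/-! ## §3 Regime «B»: `d_u = 2k+3 < N`, favourable = hyperbolic literal (REGIME-TABLE census, case `d_g2 ≥ d_u`) -/

/-- **ROW `0`, regime B, `N = 2n` even** (`n = a + k + 1`, `a ≥ 1`; top depth `d₀ = d_u = 2k+3`, `mA = k`): hyperbolic (favourable) raw total
`#R + NE·S(E_{k+1})₀ + (NP+NM)·S(P_k)₀` with `#R = m0(2a) = (q+1)Σ_{i<a}q^i`, `NE = (q+1)q^a`, `NP + NM = (q−1)q·#R`, `S(E_{k+1})₀ = Σ_{i≤k} q^{2i} + Σ_{i<k} q^{2k+1+i}`,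
`S(P_k)₀ = Σ_{i<k} q^{2i}`; anisotropic (unfavourable) total `1 + (q+1)q·S(P_k)₀`; difference `= +q^{2k+3}·X̃₀(a+k+1)` (even row-`0` socket form).
[cite: Rogawski1990, §4.9 Prop. 4.9.1 (a) p. 55] [cite: Kottwitz1986, §3] -/
theorem zero_B_even (q : K) (hq0 : q ≠ 0) (hq1 : q ≠ 1) (hq1' : q + 1 ≠ 0) (a k : ℕ) :
    ((q + 1) * ∑ i ∈ range a, q ^ i) + (q + 1) * q ^ a * (∑ i ∈ range (k + 1), q ^ (2 * i) + ∑ i ∈ range k, q ^ (2 * k + 1 + i)) +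
        (q - 1) * q * ((q + 1) * ∑ i ∈ range a, q ^ i) * ∑ i ∈ range k, q ^ (2 * i) -
      (1 + (q + 1) * q * ∑ i ∈ range k, q ^ (2 * i)) =
      q ^ (2 * k + 3) * (((q + 1) * ∑ i ∈ range (a + k + 1), q ^ i - 1) / q ^ 3) := by
  have hq2 : q ^ 2 ≠ 1 := fun h => by
    have h' : (q - 1) * (q + 1) = 0 := by linear_combination h
    rcases mul_eq_zero.1 h' with h1 | h1
    · exact hq1 (sub_eq_zero.1 h1)
    · exact hq1' h1
  have hqm1 : q - 1 ≠ 0 := sub_ne_zero.2 hq1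
  have hq21 : q ^ 2 - 1 ≠ 0 := sub_ne_zero.2 hq2
  rw [sum_range_pow_two_mul_eq_div q hq2, sum_range_pow_two_mul_eq_div q hq2, sum_range_pow_add_eq_div q hq1, sum_range_pow_eq_div q hq1,
    sum_range_pow_eq_div q hq1]
  field_simp
  ring

/-- **ROW `0`, regime B, `N = 2n+1` odd** (`n = a + k + 1`): as `zero_B_even` with `#R = m0(2a+1) = (q+1)Σ_{i<a}q^i + q^a`, `NE = m0(2a+3) − m0(2a+1) = 2q^{a+1}`, and the odd
row-`0` socket form `X̃₀(n) = 2(q^n − 1)∕((q−1)q²)`. [cite: Rogawski1990, §4.9 Prop. 4.9.1 (a) p. 55] [cite: Kottwitz1986, §3] -/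
theorem zero_B_odd (q : K) (hq0 : q ≠ 0) (hq1 : q ≠ 1) (hq1' : q + 1 ≠ 0) (a k : ℕ) :
    ((q + 1) * ∑ i ∈ range a, q ^ i + q ^ a) + 2 * q ^ (a + 1) * (∑ i ∈ range (k + 1), q ^ (2 * i) + ∑ i ∈ range k, q ^ (2 * k + 1 + i)) +
        (q - 1) * q * ((q + 1) * ∑ i ∈ range a, q ^ i + q ^ a) * ∑ i ∈ range k, q ^ (2 * i) -
      (1 + (q + 1) * q * ∑ i ∈ range k, q ^ (2 * i)) =
      q ^ (2 * k + 3) * (2 * (q ^ (a + k + 1) - 1) / ((q - 1) * q ^ 2)) := by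
  have hq2 : q ^ 2 ≠ 1 := fun h => by
    have h' : (q - 1) * (q + 1) = 0 := by linear_combination h
    rcases mul_eq_zero.1 h' with h1 | h1
    · exact hq1 (sub_eq_zero.1 h1)
    · exact hq1' h1
  have hqm1 : q - 1 ≠ 0 := sub_ne_zero.2 hq1
  have hq21 : q ^ 2 - 1 ≠ 0 := sub_ne_zero.2 hq2
  rw [sum_range_pow_two_mul_eq_div q hq2, sum_range_pow_two_mul_eq_div q hq2, sum_range_pow_add_eq_div q hq1, sum_range_pow_eq_div q hq1]
  field_simp
  ring

/-- **ROWS `1±`, regime B, `N = 2n` even** (`n = a + k + 1`): with the REGIME-TABLE census (`NP + NM = (q−1)q·#R`, `|NP − NM| = (q+1)q`, the anisotropic literal's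
`(q+1)q` collar chains in the hyperbolic literal's majority class) the class-wise difference is `q^{2k}·((q−1)q·#R − (q+1)q)∕2 + NE·C(q,2)·q^{2k}·Σ_{i<k} q^i`
(`S(P_k)_{1±} = q^{2k}` in the chain's class, `S(E_{k+1})_{1±} = C(q,2)q^{2k}Σ_{i<k}q^i`), and it equals `+q^{2k+3}·X̃_{1±}(n)`, `X̃_{1±}(n) = (q+1)(q^n − 2q)∕(2q³)`.
[cite: Rogawski1990, §4.9 Prop. 4.9.1 (a) p. 55] [cite: Kottwitz1986, §3] -/
theorem pm_B_even (q : K) (hq0 : q ≠ 0) (hq1 : q ≠ 1) (h2 : (2 : K) ≠ 0) (a k : ℕ) :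
    q ^ (2 * k) * (((q - 1) * q * ((q + 1) * ∑ i ∈ range a, q ^ i) - (q + 1) * q) / 2) +
        (q + 1) * q ^ a * (q * (q - 1) / 2) * q ^ (2 * k) * ∑ i ∈ range k, q ^ i =
      q ^ (2 * k + 3) * ((q + 1) * (q ^ (a + k + 1) - 2 * q) / (2 * q ^ 3)) := by
  have hqm1 : q - 1 ≠ 0 := sub_ne_zero.2 hq1
  rw [sum_range_pow_eq_div q hq1, sum_range_pow_eq_div q hq1]
  field_simp
  ring

/-- **ROWS `1±`, regime B, `N = 2n+1` odd** (`n = a + k + 1`; `#R = (q+1)Σ_{i<a}q^i + q^a`, `NE = 2q^{a+1}`): the class-wise difference equals `+q^{2k+3}·X̃_{1±}(n)` with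
the odd form `X̃_{1±}(n) = (q^n − q − 1)∕q²`. [cite: Rogawski1990, §4.9 Prop. 4.9.1 (a) p. 55] [cite: Kottwitz1986, §3] -/
theorem pm_B_odd (q : K) (hq0 : q ≠ 0) (hq1 : q ≠ 1) (h2 : (2 : K) ≠ 0) (a k : ℕ) :
    q ^ (2 * k) * (((q - 1) * q * ((q + 1) * ∑ i ∈ range a, q ^ i + q ^ a) - (q + 1) * q) / 2) +
        2 * q ^ (a + 1) * (q * (q - 1) / 2) * q ^ (2 * k) * ∑ i ∈ range k, q ^ i =
      q ^ (2 * k + 3) * ((q ^ (a + k + 1) - q - 1) / q ^ 2) := by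
  have hqm1 : q - 1 ≠ 0 := sub_ne_zero.2 hq1
  rw [sum_range_pow_eq_div q hq1, sum_range_pow_eq_div q hq1]
  field_simp
  ring

/-! ## §4 Regime «A-odd»: `d_u > N = 2m+3` odd (either literal may be favourable; B-p14 (g40) MEMO v2 (L1): `R = {A₀}` for both literals, favourable root children
`E_{m+1} × 2q` + `(q−1)q` rank-one chains, unfavourable root children `(q+1)q` rank-one chains) — ED. 2 -/

/-- **ROW `0`, regime A-odd** (`N = 2m+3`, `mA = m`): favourable total `1 + 2q·S(E_{m+1})₀ + (q−1)q·S(P_m)₀`, unfavourable total `1 + (q+1)q·S(P_m)₀` (either literal), so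
`Z₀(fav) − Z₀(unf) = 2q·S(E_{m+1})₀ − 2q·S(P_m)₀`, and this equals `q^N·X̃₀(m+1)` with the odd form `X̃₀(n) = 2(q^n − 1)∕((q−1)q²)`.
[cite: Rogawski1990, §4.9 Prop. 4.9.1 (a) p. 55] [cite: Kottwitz1986, §3] -/
theorem zero_Aodd (q : K) (hq0 : q ≠ 0) (hq1 : q ≠ 1) (hq1' : q + 1 ≠ 0) (m : ℕ) :
    2 * q * (∑ i ∈ range (m + 1), q ^ (2 * i) + ∑ i ∈ range m, q ^ (2 * m + 1 + i)) - 2 * q * ∑ i ∈ range m, q ^ (2 * i) =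
      q ^ (2 * m + 3) * (2 * (q ^ (m + 1) - 1) / ((q - 1) * q ^ 2)) := by
  have hq2 : q ^ 2 ≠ 1 := fun h => by
    have h' : (q - 1) * (q + 1) = 0 := by linear_combination h
    rcases mul_eq_zero.1 h' with h1 | h1
    · exact hq1 (sub_eq_zero.1 h1)
    · exact hq1' h1
  have hqm1 : q - 1 ≠ 0 := sub_ne_zero.2 hq1
  have hq21 : q ^ 2 - 1 ≠ 0 := sub_ne_zero.2 hq2
  rw [sum_range_pow_two_mul_eq_div q hq2, sum_range_pow_two_mul_eq_div q hq2, sum_range_pow_add_eq_div q hq1]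
  field_simp
  ring

/-- **ROWS `1±`, regime A-odd** (`N = 2m+3`): in either class the favourable-minus-unfavourable difference is `2q·C(q,2)·q^{2m}·Σ_{i<m} q^i − q·q^{2m}` ((L1): favourable
`2q·S(E_{m+1})_{1±} + split((q−1)q)·S(P_m)_{1±}` against unfavourable `split((q+1)q)·S(P_m)_{1±}`, the splits `((q−1)q∕2, (q−1)q∕2)` vs `((q+1)q∕2, (q+1)q∕2)` when the
hyperbolic literal is favourable and `(q(q−1), 0)` vs `(q², q)` when the anisotropic one is — class-wise difference `−q·q^{2m}` in all four cases), and it equals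
`q^N·X̃_{1±}(m+1)`, `X̃_{1±}(n) = (q^n − q − 1)∕q²` (odd `pm` socket form). [cite: Rogawski1990, §4.9 Prop. 4.9.1 (a) p. 55] [cite: Kottwitz1986, §3] -/
theorem pm_Aodd (q : K) (hq0 : q ≠ 0) (hq1 : q ≠ 1) (h2 : (2 : K) ≠ 0) (m : ℕ) :
    2 * q * (q * (q - 1) / 2) * q ^ (2 * m) * ∑ i ∈ range m, q ^ i - q * q ^ (2 * m) =
      q ^ (2 * m + 3) * ((q ^ (m + 1) - q - 1) / q ^ 2) := by
  have hqm1 : q - 1 ≠ 0 := sub_ne_zero.2 hq1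
  rw [sum_range_pow_eq_div q hq1]
  field_simp
  ring

/-! ## §5 (ED. 3) The identities at `K = ℂ`, `q = N𝔭_v` — the (Cnt2′) socket's spelling `(Ideal.absNorm v.asIdeal : ℂ)`, side conditions `q ≠ 0, 1`, `q + 1 ≠ 0` discharged -/

section AbsNorm

variable {F : Type*} [Field F] [NumberField F] (v : IsDedekindDomain.HeightOneSpectrum (NumberField.RingOfIntegers F))

/-- `(N𝔭_v : ℂ) ≠ 0` (`𝔭_v ≠ ⊥`). [cite: Serre1980Trees, II.1.1] -/
theorem natCast_absNorm_ne_zero : (Ideal.absNorm v.asIdeal : ℂ) ≠ 0 :=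
  Nat.cast_ne_zero.2 fun h => v.ne_bot (Ideal.absNorm_eq_zero_iff.1 h)

/-- `(N𝔭_v : ℂ) ≠ 1` (`𝔭_v ≠ ⊤`). [cite: Serre1980Trees, II.1.1] -/
theorem natCast_absNorm_ne_one : (Ideal.absNorm v.asIdeal : ℂ) ≠ 1 := by
  intro h
  have h1 : Ideal.absNorm v.asIdeal = 1 := by exact_mod_cast h
  exact v.isPrime.ne_top (Ideal.absNorm_eq_one_iff.1 h1)

/-- `(N𝔭_v : ℂ) + 1 ≠ 0`. [cite: Serre1980Trees, II.1.1] -/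
theorem natCast_absNorm_add_one_ne_zero : (Ideal.absNorm v.asIdeal : ℂ) + 1 ≠ 0 :=
  Nat.cast_add_one_ne_zero _

/-- `zero_Aeven` at `K = ℂ`, `q = N𝔭_v` (the socket's `(Ideal.absNorm v.asIdeal : ℂ)`), side conditions discharged. [cite: Rogawski1990, §4.9 Prop. 4.9.1 (a) p. 55] -/
theorem zero_Aeven_absNorm (m : ℕ) :
    ((Ideal.absNorm v.asIdeal : ℂ) + 1) * ∑ i ∈ range m, (Ideal.absNorm v.asIdeal : ℂ) ^ (2 * i) - (1 + ((Ideal.absNorm v.asIdeal : ℂ) + 1) * (Ideal.absNorm v.asIdeal : ℂ) * (∑ i ∈ range m, (Ideal.absNorm v.asIdeal : ℂ) ^ (2 * i) + ∑ i ∈ range m, (Ideal.absNorm v.asIdeal : ℂ) ^ (2 * m - 1 + i))) =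
      -((Ideal.absNorm v.asIdeal : ℂ) ^ (2 * (m + 1)) * ((((Ideal.absNorm v.asIdeal : ℂ) + 1) * ∑ k ∈ range (m + 1), (Ideal.absNorm v.asIdeal : ℂ) ^ k - 1) / (Ideal.absNorm v.asIdeal : ℂ) ^ 3)) :=
  zero_Aeven (Ideal.absNorm v.asIdeal : ℂ) (natCast_absNorm_ne_zero v) (natCast_absNorm_ne_one v) (natCast_absNorm_add_one_ne_zero v) m

/-- `pm_Aeven` at `K = ℂ`, `q = N𝔭_v` (the socket's `(Ideal.absNorm v.asIdeal : ℂ)`), side conditions discharged. [cite: Rogawski1990, §4.9 Prop. 4.9.1 (a) p. 55] -/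
theorem pm_Aeven_absNorm (m : ℕ) :
    ((Ideal.absNorm v.asIdeal : ℂ) + 1) / 2 * (Ideal.absNorm v.asIdeal : ℂ) ^ (2 * m) - ((Ideal.absNorm v.asIdeal : ℂ) + 1) * (Ideal.absNorm v.asIdeal : ℂ) * ((Ideal.absNorm v.asIdeal : ℂ) * ((Ideal.absNorm v.asIdeal : ℂ) - 1) / 2 * (Ideal.absNorm v.asIdeal : ℂ) ^ (2 * m - 2) * ∑ i ∈ range m, (Ideal.absNorm v.asIdeal : ℂ) ^ i) =
      -((Ideal.absNorm v.asIdeal : ℂ) ^ (2 * (m + 1)) * (((Ideal.absNorm v.asIdeal : ℂ) + 1) * ((Ideal.absNorm v.asIdeal : ℂ) ^ (m + 1) - 2 * (Ideal.absNorm v.asIdeal : ℂ)) / (2 * (Ideal.absNorm v.asIdeal : ℂ) ^ 3))) :=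
  pm_Aeven (Ideal.absNorm v.asIdeal : ℂ) (natCast_absNorm_ne_zero v) (natCast_absNorm_ne_one v) two_ne_zero m

/-- `zero_B_even` at `K = ℂ`, `q = N𝔭_v` (the socket's `(Ideal.absNorm v.asIdeal : ℂ)`), side conditions discharged. [cite: Rogawski1990, §4.9 Prop. 4.9.1 (a) p. 55] -/
theorem zero_B_even_absNorm (a k : ℕ) :
    (((Ideal.absNorm v.asIdeal : ℂ) + 1) * ∑ i ∈ range a, (Ideal.absNorm v.asIdeal : ℂ) ^ i) + ((Ideal.absNorm v.asIdeal : ℂ) + 1) * (Ideal.absNorm v.asIdeal : ℂ) ^ a * (∑ i ∈ range (k + 1), (Ideal.absNorm v.asIdeal : ℂ) ^ (2 * i) + ∑ i ∈ range k, (Ideal.absNorm v.asIdeal : ℂ) ^ (2 * k + 1 + i)) +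
        ((Ideal.absNorm v.asIdeal : ℂ) - 1) * (Ideal.absNorm v.asIdeal : ℂ) * (((Ideal.absNorm v.asIdeal : ℂ) + 1) * ∑ i ∈ range a, (Ideal.absNorm v.asIdeal : ℂ) ^ i) * ∑ i ∈ range k, (Ideal.absNorm v.asIdeal : ℂ) ^ (2 * i) -
      (1 + ((Ideal.absNorm v.asIdeal : ℂ) + 1) * (Ideal.absNorm v.asIdeal : ℂ) * ∑ i ∈ range k, (Ideal.absNorm v.asIdeal : ℂ) ^ (2 * i)) =
      (Ideal.absNorm v.asIdeal : ℂ) ^ (2 * k + 3) * ((((Ideal.absNorm v.asIdeal : ℂ) + 1) * ∑ i ∈ range (a + k + 1), (Ideal.absNorm v.asIdeal : ℂ) ^ i - 1) / (Ideal.absNorm v.asIdeal : ℂ) ^ 3) :=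
  zero_B_even (Ideal.absNorm v.asIdeal : ℂ) (natCast_absNorm_ne_zero v) (natCast_absNorm_ne_one v) (natCast_absNorm_add_one_ne_zero v) a k

/-- `zero_B_odd` at `K = ℂ`, `q = N𝔭_v` (the socket's `(Ideal.absNorm v.asIdeal : ℂ)`), side conditions discharged. [cite: Rogawski1990, §4.9 Prop. 4.9.1 (a) p. 55] -/
theorem zero_B_odd_absNorm (a k : ℕ) :
    (((Ideal.absNorm v.asIdeal : ℂ) + 1) * ∑ i ∈ range a, (Ideal.absNorm v.asIdeal : ℂ) ^ i + (Ideal.absNorm v.asIdeal : ℂ) ^ a) + 2 * (Ideal.absNorm v.asIdeal : ℂ) ^ (a + 1) * (∑ i ∈ range (k + 1), (Ideal.absNorm v.asIdeal : ℂ) ^ (2 * i) + ∑ i ∈ range k, (Ideal.absNorm v.asIdeal : ℂ) ^ (2 * k + 1 + i)) +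
        ((Ideal.absNorm v.asIdeal : ℂ) - 1) * (Ideal.absNorm v.asIdeal : ℂ) * (((Ideal.absNorm v.asIdeal : ℂ) + 1) * ∑ i ∈ range a, (Ideal.absNorm v.asIdeal : ℂ) ^ i + (Ideal.absNorm v.asIdeal : ℂ) ^ a) * ∑ i ∈ range k, (Ideal.absNorm v.asIdeal : ℂ) ^ (2 * i) -
      (1 + ((Ideal.absNorm v.asIdeal : ℂ) + 1) * (Ideal.absNorm v.asIdeal : ℂ) * ∑ i ∈ range k, (Ideal.absNorm v.asIdeal : ℂ) ^ (2 * i)) =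
      (Ideal.absNorm v.asIdeal : ℂ) ^ (2 * k + 3) * (2 * ((Ideal.absNorm v.asIdeal : ℂ) ^ (a + k + 1) - 1) / (((Ideal.absNorm v.asIdeal : ℂ) - 1) * (Ideal.absNorm v.asIdeal : ℂ) ^ 2)) :=
  zero_B_odd (Ideal.absNorm v.asIdeal : ℂ) (natCast_absNorm_ne_zero v) (natCast_absNorm_ne_one v) (natCast_absNorm_add_one_ne_zero v) a k

/-- `pm_B_even` at `K = ℂ`, `q = N𝔭_v` (the socket's `(Ideal.absNorm v.asIdeal : ℂ)`), side conditions discharged. [cite: Rogawski1990, §4.9 Prop. 4.9.1 (a) p. 55] -/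
theorem pm_B_even_absNorm (a k : ℕ) :
    (Ideal.absNorm v.asIdeal : ℂ) ^ (2 * k) * ((((Ideal.absNorm v.asIdeal : ℂ) - 1) * (Ideal.absNorm v.asIdeal : ℂ) * (((Ideal.absNorm v.asIdeal : ℂ) + 1) * ∑ i ∈ range a, (Ideal.absNorm v.asIdeal : ℂ) ^ i) - ((Ideal.absNorm v.asIdeal : ℂ) + 1) * (Ideal.absNorm v.asIdeal : ℂ)) / 2) +
        ((Ideal.absNorm v.asIdeal : ℂ) + 1) * (Ideal.absNorm v.asIdeal : ℂ) ^ a * ((Ideal.absNorm v.asIdeal : ℂ) * ((Ideal.absNorm v.asIdeal : ℂ) - 1) / 2) * (Ideal.absNorm v.asIdeal : ℂ) ^ (2 * k) * ∑ i ∈ range k, (Ideal.absNorm v.asIdeal : ℂ) ^ i =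
      (Ideal.absNorm v.asIdeal : ℂ) ^ (2 * k + 3) * (((Ideal.absNorm v.asIdeal : ℂ) + 1) * ((Ideal.absNorm v.asIdeal : ℂ) ^ (a + k + 1) - 2 * (Ideal.absNorm v.asIdeal : ℂ)) / (2 * (Ideal.absNorm v.asIdeal : ℂ) ^ 3)) :=
  pm_B_even (Ideal.absNorm v.asIdeal : ℂ) (natCast_absNorm_ne_zero v) (natCast_absNorm_ne_one v) two_ne_zero a k

/-- `pm_B_odd` at `K = ℂ`, `q = N𝔭_v` (the socket's `(Ideal.absNorm v.asIdeal : ℂ)`), side conditions discharged. [cite: Rogawski1990, §4.9 Prop. 4.9.1 (a) p. 55] -/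
theorem pm_B_odd_absNorm (a k : ℕ) :
    (Ideal.absNorm v.asIdeal : ℂ) ^ (2 * k) * ((((Ideal.absNorm v.asIdeal : ℂ) - 1) * (Ideal.absNorm v.asIdeal : ℂ) * (((Ideal.absNorm v.asIdeal : ℂ) + 1) * ∑ i ∈ range a, (Ideal.absNorm v.asIdeal : ℂ) ^ i + (Ideal.absNorm v.asIdeal : ℂ) ^ a) - ((Ideal.absNorm v.asIdeal : ℂ) + 1) * (Ideal.absNorm v.asIdeal : ℂ)) / 2) +
        2 * (Ideal.absNorm v.asIdeal : ℂ) ^ (a + 1) * ((Ideal.absNorm v.asIdeal : ℂ) * ((Ideal.absNorm v.asIdeal : ℂ) - 1) / 2) * (Ideal.absNorm v.asIdeal : ℂ) ^ (2 * k) * ∑ i ∈ range k, (Ideal.absNorm v.asIdeal : ℂ) ^ i =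
      (Ideal.absNorm v.asIdeal : ℂ) ^ (2 * k + 3) * (((Ideal.absNorm v.asIdeal : ℂ) ^ (a + k + 1) - (Ideal.absNorm v.asIdeal : ℂ) - 1) / (Ideal.absNorm v.asIdeal : ℂ) ^ 2) :=
  pm_B_odd (Ideal.absNorm v.asIdeal : ℂ) (natCast_absNorm_ne_zero v) (natCast_absNorm_ne_one v) two_ne_zero a k

/-- `zero_Aodd` at `K = ℂ`, `q = N𝔭_v` (the socket's `(Ideal.absNorm v.asIdeal : ℂ)`), side conditions discharged. [cite: Rogawski1990, §4.9 Prop. 4.9.1 (a) p. 55] -/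
theorem zero_Aodd_absNorm (m : ℕ) :
    2 * (Ideal.absNorm v.asIdeal : ℂ) * (∑ i ∈ range (m + 1), (Ideal.absNorm v.asIdeal : ℂ) ^ (2 * i) + ∑ i ∈ range m, (Ideal.absNorm v.asIdeal : ℂ) ^ (2 * m + 1 + i)) - 2 * (Ideal.absNorm v.asIdeal : ℂ) * ∑ i ∈ range m, (Ideal.absNorm v.asIdeal : ℂ) ^ (2 * i) =
      (Ideal.absNorm v.asIdeal : ℂ) ^ (2 * m + 3) * (2 * ((Ideal.absNorm v.asIdeal : ℂ) ^ (m + 1) - 1) / (((Ideal.absNorm v.asIdeal : ℂ) - 1) * (Ideal.absNorm v.asIdeal : ℂ) ^ 2)) :=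
  zero_Aodd (Ideal.absNorm v.asIdeal : ℂ) (natCast_absNorm_ne_zero v) (natCast_absNorm_ne_one v) (natCast_absNorm_add_one_ne_zero v) m

/-- `pm_Aodd` at `K = ℂ`, `q = N𝔭_v` (the socket's `(Ideal.absNorm v.asIdeal : ℂ)`), side conditions discharged. [cite: Rogawski1990, §4.9 Prop. 4.9.1 (a) p. 55] -/
theorem pm_Aodd_absNorm (m : ℕ) :
    2 * (Ideal.absNorm v.asIdeal : ℂ) * ((Ideal.absNorm v.asIdeal : ℂ) * ((Ideal.absNorm v.asIdeal : ℂ) - 1) / 2) * (Ideal.absNorm v.asIdeal : ℂ) ^ (2 * m) * ∑ i ∈ range m, (Ideal.absNorm v.asIdeal : ℂ) ^ i - (Ideal.absNorm v.asIdeal : ℂ) * (Ideal.absNorm v.asIdeal : ℂ) ^ (2 * m) =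
      (Ideal.absNorm v.asIdeal : ℂ) ^ (2 * m + 3) * (((Ideal.absNorm v.asIdeal : ℂ) ^ (m + 1) - (Ideal.absNorm v.asIdeal : ℂ) - 1) / (Ideal.absNorm v.asIdeal : ℂ) ^ 2) :=
  pm_Aodd (Ideal.absNorm v.asIdeal : ℂ) (natCast_absNorm_ne_zero v) (natCast_absNorm_ne_one v) two_ne_zero m

end AbsNorm

/-! ## §6 (ED. 4) CENSUS ADAPTERS — the same identities keyed on ABSTRACT census atoms + census equalities (the (α) keeper's v1 shape, RULING (13) (1)):
each `J0diff` branch closes by `linear_combination` from its `stub_Z*`∕`stub_census_*` equalities and ONE of these -/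

section Census

variable (q : K)

/-- **Row `0`, regime B, even `N`** — census atoms: hyperbolic `#R = R`, `NE`, rank-one chain counts `NP, NM` (any split with `NP + NM = (q−1)q·R`), anisotropic chain
count `Na = (q+1)q`; tokens `SE := S(E_{k+1})₀`, `SP := S(P_k)₀` in the ★ ShellSums spelling. [cite: Rogawski1990, §4.9 Prop. 4.9.1 (a) p. 55] [cite: Kottwitz1986, §3] -/
theorem zero_B_even_census (hq0 : q ≠ 0) (hq1 : q ≠ 1) (hq1' : q + 1 ≠ 0) (a k : ℕ) {R NE NP NM Na : K}
    (hR : R = (q + 1) * ∑ i ∈ range a, q ^ i) (hNE : NE = (q + 1) * q ^ a) (hP : NP + NM = (q - 1) * q * R) (hNa : Na = (q + 1) * q) :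
    (R + NE * (∑ i ∈ range (k + 1), q ^ (2 * i) + ∑ i ∈ range k, q ^ (2 * k + 1 + i)) + NP * ∑ i ∈ range k, q ^ (2 * i) + NM * ∑ i ∈ range k, q ^ (2 * i)) -
        (1 + Na * ∑ i ∈ range k, q ^ (2 * i)) =
      q ^ (2 * k + 3) * (((q + 1) * ∑ i ∈ range (a + k + 1), q ^ i - 1) / q ^ 3) := by
  subst hR hNE hNa
  linear_combination (∑ i ∈ range k, q ^ (2 * i)) * hP + zero_B_even q hq0 hq1 hq1' a k

/-- **Row `0`, regime B, odd `N`** (`#R = (q+1)Σ_{i<a}q^i + q^a`, `NE = 2q^{a+1}`). [cite: Rogawski1990, §4.9 Prop. 4.9.1 (a) p. 55] [cite: Kottwitz1986, §3] -/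
theorem zero_B_odd_census (hq0 : q ≠ 0) (hq1 : q ≠ 1) (hq1' : q + 1 ≠ 0) (a k : ℕ) {R NE NP NM Na : K}
    (hR : R = (q + 1) * ∑ i ∈ range a, q ^ i + q ^ a) (hNE : NE = 2 * q ^ (a + 1)) (hP : NP + NM = (q - 1) * q * R) (hNa : Na = (q + 1) * q) :
    (R + NE * (∑ i ∈ range (k + 1), q ^ (2 * i) + ∑ i ∈ range k, q ^ (2 * k + 1 + i)) + NP * ∑ i ∈ range k, q ^ (2 * i) + NM * ∑ i ∈ range k, q ^ (2 * i)) -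
        (1 + Na * ∑ i ∈ range k, q ^ (2 * i)) =
      q ^ (2 * k + 3) * (2 * (q ^ (a + k + 1) - 1) / ((q - 1) * q ^ 2)) := by
  subst hR hNE hNa
  linear_combination (∑ i ∈ range k, q ^ (2 * i)) * hP + zero_B_odd q hq0 hq1 hq1' a k

/-- **Rows `1±`, regime B, even `N`**, one class `c`: hyperbolic count `Nh·q^{2k} + NE·(C·q^{2k}·Σ_{i<k}q^i)` (`Nh` = the chains of the class landing in `c` at depth
`k`, `C = C(q,2)` read as `q(q−1)∕2`), anisotropic count `Nan·q^{2k}`, census `Nh − Nan = ((q−1)q·R − (q+1)q)∕2` (majority class: `Nh = ((q−1)qR + (q+1)q)∕2`,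
`Nan = (q+1)q`; minority: `Nh = ((q−1)qR − (q+1)q)∕2`, `Nan = 0`). [cite: Rogawski1990, §4.9 Prop. 4.9.1 (a) p. 55] [cite: Kottwitz1986, §3] -/
theorem pm_B_even_census (hq0 : q ≠ 0) (hq1 : q ≠ 1) (h2 : (2 : K) ≠ 0) (a k : ℕ) {R NE Nh Nan C : K}
    (hR : R = (q + 1) * ∑ i ∈ range a, q ^ i) (hNE : NE = (q + 1) * q ^ a) (hd : Nh - Nan = ((q - 1) * q * R - (q + 1) * q) / 2) (hC : C = q * (q - 1) / 2) :
    (Nh * q ^ (2 * k) + NE * (C * q ^ (2 * k) * ∑ i ∈ range k, q ^ i)) - Nan * q ^ (2 * k) =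
      q ^ (2 * k + 3) * ((q + 1) * (q ^ (a + k + 1) - 2 * q) / (2 * q ^ 3)) := by
  subst hR hNE hC
  linear_combination q ^ (2 * k) * hd + pm_B_even q hq0 hq1 h2 a k

/-- **Rows `1±`, regime B, odd `N`** (`#R = (q+1)Σ_{i<a}q^i + q^a`, `NE = 2q^{a+1}`). [cite: Rogawski1990, §4.9 Prop. 4.9.1 (a) p. 55] [cite: Kottwitz1986, §3] -/
theorem pm_B_odd_census (hq0 : q ≠ 0) (hq1 : q ≠ 1) (h2 : (2 : K) ≠ 0) (a k : ℕ) {R NE Nh Nan C : K}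
    (hR : R = (q + 1) * ∑ i ∈ range a, q ^ i + q ^ a) (hNE : NE = 2 * q ^ (a + 1)) (hd : Nh - Nan = ((q - 1) * q * R - (q + 1) * q) / 2) (hC : C = q * (q - 1) / 2) :
    (Nh * q ^ (2 * k) + NE * (C * q ^ (2 * k) * ∑ i ∈ range k, q ^ i)) - Nan * q ^ (2 * k) =
      q ^ (2 * k + 3) * ((q ^ (a + k + 1) - q - 1) / q ^ 2) := by
  subst hR hNE hC
  linear_combination q ^ (2 * k) * hd + pm_B_odd q hq0 hq1 h2 a k

/-- **Row `0`, regime A-even** (`N = 2(m+1)`): hyperbolic total `Zh = (q+1)Σ_{i<m}q^{2i}` (from its own census), anisotropic `1 + NO·S(O_m)₀` with `NO = (q+1)q`.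
[cite: Rogawski1990, §4.9 Prop. 4.9.1 (a) p. 55] [cite: Kottwitz1986, §3] -/
theorem zero_Aeven_census (hq0 : q ≠ 0) (hq1 : q ≠ 1) (hq1' : q + 1 ≠ 0) (m : ℕ) {Zh NO : K}
    (hZh : Zh = (q + 1) * ∑ i ∈ range m, q ^ (2 * i)) (hNO : NO = (q + 1) * q) :
    Zh - (1 + NO * (∑ i ∈ range m, q ^ (2 * i) + ∑ i ∈ range m, q ^ (2 * m - 1 + i))) =
      -(q ^ (2 * (m + 1)) * (((q + 1) * ∑ k ∈ range (m + 1), q ^ k - 1) / q ^ 3)) := by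
  subst hZh hNO
  exact zero_Aeven q hq0 hq1 hq1' m

/-- **Rows `1±`, regime A-even** (`N = 2(m+1)`), one class: hyperbolic total `Zh = (q+1)∕2·q^{2m}`, anisotropic `NO·(C·q^{2m−2}·Σ_{i<m}q^i)`, `NO = (q+1)q`,
`C = q(q−1)∕2`. [cite: Rogawski1990, §4.9 Prop. 4.9.1 (a) p. 55] [cite: Kottwitz1986, §3] -/
theorem pm_Aeven_census (hq0 : q ≠ 0) (hq1 : q ≠ 1) (h2 : (2 : K) ≠ 0) (m : ℕ) {Zh NO C : K}
    (hZh : Zh = (q + 1) / 2 * q ^ (2 * m)) (hNO : NO = (q + 1) * q) (hC : C = q * (q - 1) / 2) :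
    Zh - NO * (C * q ^ (2 * m - 2) * ∑ i ∈ range m, q ^ i) = -(q ^ (2 * (m + 1)) * ((q + 1) * (q ^ (m + 1) - 2 * q) / (2 * q ^ 3))) := by
  subst hZh hNO hC
  linear_combination pm_Aeven q hq0 hq1 h2 m

/-- **Row `0`, regimes A-odd ∕ tie** (`N = 2m+3`; FAVOURABLE minus UNFAVOURABLE literal — multiply by `τ` outside): favourable root `NE = 2q` chains `E_{m+1}` + `F` rank-one chains,
unfavourable root `U` rank-one chains, census `U − F = 2q` (`F = q(q−1)`, `U = (q+1)q`). [cite: Rogawski1990, §4.9 Prop. 4.9.1 (a) p. 55] [cite: Kottwitz1986, §3] -/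
theorem zero_Aodd_census (hq0 : q ≠ 0) (hq1 : q ≠ 1) (hq1' : q + 1 ≠ 0) (m : ℕ) {NE F U : K} (hNE : NE = 2 * q) (hFU : U - F = 2 * q) :
    (1 + NE * (∑ i ∈ range (m + 1), q ^ (2 * i) + ∑ i ∈ range m, q ^ (2 * m + 1 + i)) + F * ∑ i ∈ range m, q ^ (2 * i)) -
        (1 + U * ∑ i ∈ range m, q ^ (2 * i)) =
      q ^ (2 * m + 3) * (2 * (q ^ (m + 1) - 1) / ((q - 1) * q ^ 2)) := by
  subst hNE
  linear_combination (-(∑ i ∈ range m, q ^ (2 * i))) * hFU + zero_Aodd q hq0 hq1 hq1' m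

/-- **Rows `1±`, regimes A-odd ∕ tie**, one class `c` (FAVOURABLE minus UNFAVOURABLE): favourable `NE·(C·q^{2m}·Σ_{i<m}q^i) + Fc·q^{2m}`, unfavourable `Uc·q^{2m}`,
census `Uc − Fc = q` in each class (B-p14 (g40) MEMO v2 (L1)∕(L3)), `NE = 2q`, `C = q(q−1)∕2`. [cite: Rogawski1990, §4.9 Prop. 4.9.1 (a) p. 55] [cite: Kottwitz1986, §3] -/
theorem pm_Aodd_census (hq0 : q ≠ 0) (hq1 : q ≠ 1) (h2 : (2 : K) ≠ 0) (m : ℕ) {NE Fc Uc C : K}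
    (hNE : NE = 2 * q) (hc : Uc - Fc = q) (hC : C = q * (q - 1) / 2) :
    (NE * (C * q ^ (2 * m) * ∑ i ∈ range m, q ^ i) + Fc * q ^ (2 * m)) - Uc * q ^ (2 * m) =
      q ^ (2 * m + 3) * ((q ^ (m + 1) - q - 1) / q ^ 2) := by
  subst hNE hC
  linear_combination (-(q ^ (2 * m))) * hc + pm_Aodd q hq0 hq1 h2 m

end Census

/-! ## §7 (ED. 5) Rows `1±` in regime B WITHOUT division: the ORIENTATION as two cases (the anisotropic root chains land in the row's class — «major» — or not —
«minor»), census atoms per literal in `ℕ`-friendly form (`Nc + Nc' = (q−1)q·R`, `Nc = Nc' + (q+1)q` resp. `Nc' = Nc + (q+1)q`; `Nan = (q+1)q` resp. `0`) -/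

section Orientation

variable (q : K)

/-- **Rows `1±`, regime B, even `N`, MAJOR class** (the row's class receives the anisotropic root chains: `Nan = (q+1)q`, and the hyperbolic majority: `Nc = Nc' + (q+1)q`,
`Nc + Nc' = (q−1)q·R`). [cite: Rogawski1990, §4.9 Prop. 4.9.1 (a) p. 55] [cite: Kottwitz1986, §3] -/
theorem pm_B_even_census_major (hq0 : q ≠ 0) (hq1 : q ≠ 1) (h2 : (2 : K) ≠ 0) (a k : ℕ) {R NE Nc Nc' Nan C : K}
    (hR : R = (q + 1) * ∑ i ∈ range a, q ^ i) (hNE : NE = (q + 1) * q ^ a) (hsum : Nc + Nc' = (q - 1) * q * R) (hmaj : Nc = Nc' + (q + 1) * q)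
    (hNan : Nan = (q + 1) * q) (hC : C = q * (q - 1) / 2) :
    (Nc * q ^ (2 * k) + NE * (C * q ^ (2 * k) * ∑ i ∈ range k, q ^ i)) - Nan * q ^ (2 * k) =
      q ^ (2 * k + 3) * ((q + 1) * (q ^ (a + k + 1) - 2 * q) / (2 * q ^ 3)) :=
  pm_B_even_census q hq0 hq1 h2 a k hR hNE (by rw [hNan, eq_div_iff h2]; linear_combination hsum + hmaj) hC

/-- **Rows `1±`, regime B, even `N`, MINOR class** (`Nan = 0`, `Nc' = Nc + (q+1)q`). [cite: Rogawski1990, §4.9 Prop. 4.9.1 (a) p. 55] [cite: Kottwitz1986, §3] -/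
theorem pm_B_even_census_minor (hq0 : q ≠ 0) (hq1 : q ≠ 1) (h2 : (2 : K) ≠ 0) (a k : ℕ) {R NE Nc Nc' Nan C : K}
    (hR : R = (q + 1) * ∑ i ∈ range a, q ^ i) (hNE : NE = (q + 1) * q ^ a) (hsum : Nc + Nc' = (q - 1) * q * R) (hmin : Nc' = Nc + (q + 1) * q)
    (hNan : Nan = 0) (hC : C = q * (q - 1) / 2) :
    (Nc * q ^ (2 * k) + NE * (C * q ^ (2 * k) * ∑ i ∈ range k, q ^ i)) - Nan * q ^ (2 * k) =
      q ^ (2 * k + 3) * ((q + 1) * (q ^ (a + k + 1) - 2 * q) / (2 * q ^ 3)) :=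
  pm_B_even_census q hq0 hq1 h2 a k hR hNE (by rw [hNan, eq_div_iff h2]; linear_combination hsum - hmin) hC

/-- **Rows `1±`, regime B, odd `N`, MAJOR class** (`#R = (q+1)Σ_{i<a}q^i + q^a`, `NE = 2q^{a+1}`). [cite: Rogawski1990, §4.9 Prop. 4.9.1 (a) p. 55] [cite: Kottwitz1986, §3] -/
theorem pm_B_odd_census_major (hq0 : q ≠ 0) (hq1 : q ≠ 1) (h2 : (2 : K) ≠ 0) (a k : ℕ) {R NE Nc Nc' Nan C : K}
    (hR : R = (q + 1) * ∑ i ∈ range a, q ^ i + q ^ a) (hNE : NE = 2 * q ^ (a + 1)) (hsum : Nc + Nc' = (q - 1) * q * R) (hmaj : Nc = Nc' + (q + 1) * q)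
    (hNan : Nan = (q + 1) * q) (hC : C = q * (q - 1) / 2) :
    (Nc * q ^ (2 * k) + NE * (C * q ^ (2 * k) * ∑ i ∈ range k, q ^ i)) - Nan * q ^ (2 * k) =
      q ^ (2 * k + 3) * ((q ^ (a + k + 1) - q - 1) / q ^ 2) :=
  pm_B_odd_census q hq0 hq1 h2 a k hR hNE (by rw [hNan, eq_div_iff h2]; linear_combination hsum + hmaj) hC

/-- **Rows `1±`, regime B, odd `N`, MINOR class.** [cite: Rogawski1990, §4.9 Prop. 4.9.1 (a) p. 55] [cite: Kottwitz1986, §3] -/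
theorem pm_B_odd_census_minor (hq0 : q ≠ 0) (hq1 : q ≠ 1) (h2 : (2 : K) ≠ 0) (a k : ℕ) {R NE Nc Nc' Nan C : K}
    (hR : R = (q + 1) * ∑ i ∈ range a, q ^ i + q ^ a) (hNE : NE = 2 * q ^ (a + 1)) (hsum : Nc + Nc' = (q - 1) * q * R) (hmin : Nc' = Nc + (q + 1) * q)
    (hNan : Nan = 0) (hC : C = q * (q - 1) / 2) :
    (Nc * q ^ (2 * k) + NE * (C * q ^ (2 * k) * ∑ i ∈ range k, q ^ i)) - Nan * q ^ (2 * k) =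
      q ^ (2 * k + 3) * ((q ^ (a + k + 1) - q - 1) / q ^ 2) :=
  pm_B_odd_census q hq0 hq1 h2 a k hR hNE (by rw [hNan, eq_div_iff h2]; linear_combination hsum - hmin) hC

end Orientation

end Literature.NumberTheory.Rogawski1990.BlockLawArith
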